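import Summits.SmoothPoincare4.SmoothPoincare4.Theorems.SymplecticOrigamiFoldedSphereFoldExistencePolarChart
import Summits.SmoothPoincare4.SmoothPoincare4.Theorems.SymplecticOrigamiFoldedSphereFoldExistenceStereoChart
import Summits.SmoothPoincare4.SmoothPoincare4.Theorems.SymplecticOrigamiFoldedSphereFoldExistenceFoldPullbackMain

/-!
# Non-vacuity of `eliashberg_foldMap_homotopySphere_four` at the round sphere

Helper file for item `FoldedSphereFoldExistence` (route SymplecticOrigami). The named fact
`Literature.Topology.FourManifolds.eliashberg_foldMap_homotopySphere_four` (a fold map `M → ℝ⁴`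
along a chart 3-sphere on every homotopy 4-sphere) is witnessed at `M = S⁴` by Gromov's Example
(PDR §2.1.3 (D)): `e = σ⁻¹` the inverse equatorial stereographic projection (`stereoSouth.symm`),
`f` the vertical projection `x ↦ x'`, folding along the equator `e(S³)`; the fold charts at an
equator point `e n` are `φ = polarChart i ε ∘ σ` and `ψ = N ∘ polarChart i ε` (`N` negates the
radial coordinate), for a coordinate `i` with `ε nᵢ > 0`: in the chart `σ` the projection reads
`y ↦ 2y/(1 + ‖y‖²)`, and `(1 - ρ)/(1 + ρ) = ((r - 1)/(r + 1))²` for `ρ = 2r/(1 + r²)`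
(`eliashberg_foldMap_sphere`). Consequently the fold-map pull-back lemma applies at `S⁴`
(`isFoldedForm_projection_sphere`: a second, fold-map proof of rung 0 at the round sphere).
-/

noncomputable section

-- the prescribed namespace `Summit.<P>.<Sub>.…` duplicates `SmoothPoincare4` (P = Sub)
set_option linter.dupNamespace false

open scoped Manifold ContDiff Topology
open Set Function Metric
open Literature.Geometry.Symplectic

namespace Summit.SmoothPoincare4.SmoothPoincare4.Theorems.FoldedSphereFoldExistence

/-! ### The reflection of the radial coordinate -/

/-- `u ↦ u - 2u₀ e₀` (negate the first coordinate) as a continuous linear map. [folklore] -/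
def negZeroCLM : EuclideanSpace ℝ (Fin 4) →L[ℝ] EuclideanSpace ℝ (Fin 4) :=
  ContinuousLinearMap.id ℝ (EuclideanSpace ℝ (Fin 4)) -
    ((2 : ℝ) • (EuclideanSpace.proj (0 : Fin 4) : EuclideanSpace ℝ (Fin 4) →L[ℝ] ℝ)).smulRight
      (EuclideanSpace.single (0 : Fin 4) (1 : ℝ))

/-- First coordinate of the reflection. [folklore] -/
@[simp] theorem negZeroCLM_apply_zero (u : EuclideanSpace ℝ (Fin 4)) : negZeroCLM u 0 = -u 0 := by
  simp [negZeroCLM]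
  ring

/-- Other coordinates of the reflection. [folklore] -/
@[simp] theorem negZeroCLM_apply_succ (u : EuclideanSpace ℝ (Fin 4)) (k : Fin 3) :
    negZeroCLM u k.succ = u k.succ := by
  simp [negZeroCLM, Fin.succ_ne_zero]

/-- The reflection is an involution. [folklore] -/
theorem negZeroCLM_negZeroCLM (u : EuclideanSpace ℝ (Fin 4)) : negZeroCLM (negZeroCLM u) = u := by
  ext j
  refine Fin.cases ?_ (fun k => ?_) j
  · rw [negZeroCLM_apply_zero, negZeroCLM_apply_zero, neg_neg]
  · rw [negZeroCLM_apply_succ, negZeroCLM_apply_succ]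

/-- The reflection as a continuous linear equivalence. [folklore] -/
def negZero : EuclideanSpace ℝ (Fin 4) ≃L[ℝ] EuclideanSpace ℝ (Fin 4) :=
  ContinuousLinearEquiv.equivOfInverse negZeroCLM negZeroCLM negZeroCLM_negZeroCLM
    negZeroCLM_negZeroCLM

/-- The reflection as a function. [folklore] -/
@[simp] theorem negZero_apply (u : EuclideanSpace ℝ (Fin 4)) : negZero u = negZeroCLM u := rfl

/-- The inverse reflection as a function. [folklore] -/
@[simp] theorem negZero_symm_apply (u : EuclideanSpace ℝ (Fin 4)) : negZero.symm u = negZeroCLM u :=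
  rfl

/-! ### The fold charts -/

/-- The source fold chart at the equator: `φ = polarChart i ε ∘ σ`. [folklore] -/
def foldChartSource (i : Fin 4) (ε : ℝ) (hε : ε = 1 ∨ ε = -1) :
    OpenPartialHomeomorph (sphere (0 : EuclideanSpace ℝ (Fin 5)) 1) (EuclideanSpace ℝ (Fin 4)) :=
  stereoSouth.trans (polarChart i ε hε)

/-- The target fold chart: `ψ = N ∘ polarChart i ε`. [folklore] -/
def foldChartTarget (i : Fin 4) (ε : ℝ) (hε : ε = 1 ∨ ε = -1) :
    OpenPartialHomeomorph (EuclideanSpace ℝ (Fin 4)) (EuclideanSpace ℝ (Fin 4)) :=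
  (polarChart i ε hε).transHomeomorph negZero.toHomeomorph

/-- The source fold chart belongs to the maximal atlas of `S⁴`. [folklore] -/
theorem foldChartSource_mem_maximalAtlas (i : Fin 4) (ε : ℝ) (hε : ε = 1 ∨ ε = -1) :
    foldChartSource i ε hε ∈ IsManifold.maximalAtlas (𝓡 4) ∞
      (sphere (0 : EuclideanSpace ℝ (Fin 5)) 1) := by
  refine (foldChartSource i ε hε).mem_maximalAtlas_of_contMDiffOn ?_ ?_
  · -- `φ = polar ∘ σ`
    have h1 : ContMDiffOn 𝓘(ℝ, EuclideanSpace ℝ (Fin 4)) 𝓘(ℝ, EuclideanSpace ℝ (Fin 4)) ∞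
        (polarChart i ε hε) (polarChart i ε hε).source :=
      contMDiffOn_of_mem_maximalAtlas (polarChart_mem_maximalAtlas i ε hε)
    rw [foldChartSource, OpenPartialHomeomorph.coe_trans, OpenPartialHomeomorph.trans_source]
    exact h1.comp (contMDiffOn_stereoSouth.mono fun x hx => hx.1) fun x hx => hx.2
  · -- `φ.symm = σ.symm ∘ polar.symm`
    have h1 : ContMDiffOn 𝓘(ℝ, EuclideanSpace ℝ (Fin 4)) 𝓘(ℝ, EuclideanSpace ℝ (Fin 4)) ∞
        (polarChart i ε hε).symm (polarChart i ε hε).target :=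
      contMDiffOn_symm_of_mem_maximalAtlas (polarChart_mem_maximalAtlas i ε hε)
    refine (contMDiff_stereoSouth_symm.comp_contMDiffOn h1).congr_mono (fun y hy => rfl) ?_
    intro y hy
    exact hy.1

/-- The target fold chart belongs to the maximal atlas of `ℝ⁴`. [folklore] -/
theorem foldChartTarget_mem_maximalAtlas (i : Fin 4) (ε : ℝ) (hε : ε = 1 ∨ ε = -1) :
    foldChartTarget i ε hε ∈ IsManifold.maximalAtlas (𝓡 4) ∞ (EuclideanSpace ℝ (Fin 4)) := by
  refine (foldChartTarget i ε hε).mem_maximalAtlas_of_contMDiffOn ?_ ?_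
  · have h1 : ContMDiffOn 𝓘(ℝ, EuclideanSpace ℝ (Fin 4)) 𝓘(ℝ, EuclideanSpace ℝ (Fin 4)) ∞
        (polarChart i ε hε) (polarChart i ε hε).source :=
      contMDiffOn_of_mem_maximalAtlas (polarChart_mem_maximalAtlas i ε hε)
    exact (negZero : EuclideanSpace ℝ (Fin 4) →L[ℝ] EuclideanSpace ℝ (Fin 4)).contMDiff.comp_contMDiffOn h1
  · have h1 : ContMDiffOn 𝓘(ℝ, EuclideanSpace ℝ (Fin 4)) 𝓘(ℝ, EuclideanSpace ℝ (Fin 4)) ∞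
        (polarChart i ε hε).symm (polarChart i ε hε).target :=
      contMDiffOn_symm_of_mem_maximalAtlas (polarChart_mem_maximalAtlas i ε hε)
    refine h1.comp (negZero.symm : EuclideanSpace ℝ (Fin 4) →L[ℝ]
      EuclideanSpace ℝ (Fin 4)).contMDiff.contMDiffOn fun p hp => ?_
    exact hp

/-! ### The projection in the chart, and the fold identity -/

/-- In the equatorial chart the vertical projection reads `y ↦ (2/(1 + ‖y‖²)) y`:
`P x = c • σ x`, `c = 2/(1 + ‖σ x‖²)`, for `x` off the south pole. [folklore] -/
theorem projFour_eq_smul_stereoSouth (x : sphere (0 : EuclideanSpace ℝ (Fin 5)) 1)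
    (hx : x ∈ stereoSouth.source) :
    projFour (x : EuclideanSpace ℝ (Fin 5)) = (2 / (1 + ‖stereoSouth x‖ ^ 2)) • stereoSouth x := by
  have h1 : x = stereoSouth.symm (stereoSouth x) := (stereoSouth.left_inv hx).symm
  conv_lhs => rw [h1]
  rw [coe_stereoSouth_symm_apply, projFour_stereoInvSouth]

/-- The fold identity in coordinates: `(1 - cr)/(1 + cr) = ((r-1)/(r+1))²` for
`c = 2/(1+r²)`. [folklore] -/
theorem fold_radial_identity {r : ℝ} (hr : 0 ≤ r) :
    (1 - 2 / (1 + r ^ 2) * r) / (1 + 2 / (1 + r ^ 2) * r) = ((r - 1) / (r + 1)) ^ 2 := by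
  have h1 : (1 : ℝ) + r ^ 2 ≠ 0 := by positivity
  have h2 : (r : ℝ) + 1 ≠ 0 := by positivity
  have h3 : (1 : ℝ) + 2 / (1 + r ^ 2) * r ≠ 0 := by positivity
  field_simp
  ring

/-- **The fold normal form**: for `x` in the source of `φ = polar ∘ σ`,
`ψ (P x) = φ x + ((φ x)₀² - (φ x)₀) e₀`. [folklore] -/
theorem foldChart_identity (i : Fin 4) (ε : ℝ) (hε : ε = 1 ∨ ε = -1)
    (x : sphere (0 : EuclideanSpace ℝ (Fin 5)) 1) (hx : x ∈ (foldChartSource i ε hε).source) :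
    foldChartTarget i ε hε (projFour (x : EuclideanSpace ℝ (Fin 5))) =
      foldChartSource i ε hε x + ((foldChartSource i ε hε x 0) ^ 2 - foldChartSource i ε hε x 0) •
        EuclideanSpace.single (0 : Fin 4) (1 : ℝ) := by
  obtain ⟨hx1, hx2⟩ := hx
  set y := stereoSouth x with hy
  have hyi : 0 < ε * y i := hx2
  have hy0 : y ≠ 0 := by
    intro h0
    rw [h0] at hyi
    simp at hyi
  have hr : 0 < ‖y‖ := norm_pos_iff.2 hy0
  set c : ℝ := 2 / (1 + ‖y‖ ^ 2) with hc
  have hcpos : 0 < c := by positivity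
  have hP : projFour (x : EuclideanSpace ℝ (Fin 5)) = c • y := projFour_eq_smul_stereoSouth x hx1
  have hnorm : ‖c • y‖ = c * ‖y‖ := by rw [norm_smul, Real.norm_eq_abs, abs_of_pos hcpos]
  have hφ : ∀ j, foldChartSource i ε hε x j = polarFun i y j := fun j => rfl
  have hψ : ∀ w j, foldChartTarget i ε hε w j = negZeroCLM (polarFun i w) j := fun w j => rfl
  ext j
  rw [PiLp.add_apply, PiLp.smul_apply, hψ, hP, hφ, hφ]
  refine Fin.cases ?_ (fun k => ?_) j
  · rw [negZeroCLM_apply_zero, polarFun_apply_zero, polarFun_apply_zero, hnorm]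
    simp only [PiLp.single_apply, if_true, smul_eq_mul, mul_one]
    have h := fold_radial_identity hr.le
    rw [← hc] at h
    have h4 : -((c * ‖y‖ - 1) / (c * ‖y‖ + 1)) = (1 - c * ‖y‖) / (1 + c * ‖y‖) := by
      rw [add_comm (c * ‖y‖) 1, ← neg_sub 1 (c * ‖y‖), neg_div, neg_neg]
    rw [h4, h]
    ring
  · rw [negZeroCLM_apply_succ, polarFun_apply_succ, polarFun_apply_succ, hnorm]
    have hne : (k.succ : Fin 4) ≠ 0 := Fin.succ_ne_zero k
    simp only [PiLp.smul_apply, smul_eq_mul, PiLp.single_apply, hne, if_false, mul_zero, add_zero]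
    field_simp

/-- **The equator in the chart**: for `x` in the source of `φ`, `x` lies on the equator
`σ⁻¹(S³)` iff `(φ x)₀ = 0` (iff `‖σ x‖ = 1`). [folklore] -/
theorem mem_range_iff_foldChart_zero (i : Fin 4) (ε : ℝ) (hε : ε = 1 ∨ ε = -1)
    (x : sphere (0 : EuclideanSpace ℝ (Fin 5)) 1) (hx : x ∈ (foldChartSource i ε hε).source) :
    x ∈ range (fun n : sphere (0 : EuclideanSpace ℝ (Fin 4)) 1 => stereoSouth.symm n) ↔
      foldChartSource i ε hε x 0 = 0 := by
  obtain ⟨hx1, hx2⟩ := hx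
  have hφ0 : foldChartSource i ε hε x 0 = (‖stereoSouth x‖ - 1) / (‖stereoSouth x‖ + 1) :=
    polarFun_apply_zero i _
  rw [hφ0, div_eq_zero_iff, or_iff_left (by positivity), sub_eq_zero]
  constructor
  · rintro ⟨n, hn⟩
    rw [← hn, stereoSouth.right_inv (by simp [stereoSouth_target]), norm_eq_of_mem_sphere]
  · intro h1
    refine ⟨⟨stereoSouth x, by rwa [mem_sphere_zero_iff_norm]⟩, ?_⟩
    exact stereoSouth.left_inv hx1

/-- A point of the equator `{x₄ = 0}` is `σ⁻¹` of the unit vector `x'`. [folklore] -/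
theorem mem_range_of_apply_four_eq_zero (x : sphere (0 : EuclideanSpace ℝ (Fin 5)) 1)
    (hx : (x : EuclideanSpace ℝ (Fin 5)) 4 = 0) :
    x ∈ range (fun n : sphere (0 : EuclideanSpace ℝ (Fin 4)) 1 => stereoSouth.symm n) := by
  have hn : projFour (x : EuclideanSpace ℝ (Fin 5)) ∈ sphere (0 : EuclideanSpace ℝ (Fin 4)) 1 := by
    rw [mem_sphere_zero_iff_norm]
    have h1 : ‖projFour (x : EuclideanSpace ℝ (Fin 5))‖ ^ 2 = 1 := by
      rw [EuclideanSpace.real_norm_sq_eq, Fin.sum_univ_four]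
      simp only [projFour_apply_zero, projFour_apply_one, projFour_apply_two, projFour_apply_three]
      rw [sum_sq_four_eq x, hx]
      ring
    exact (pow_eq_one_iff_of_nonneg (norm_nonneg _) two_ne_zero).1 h1
  refine ⟨⟨_, hn⟩, ?_⟩
  apply Subtype.ext
  rw [coe_stereoSouth_symm_apply]
  have h := stereoInvSouth_unit ⟨_, hn⟩
  simp only at h
  rw [h]
  ext j
  fin_cases j
  · rfl
  · rfl
  · rfl
  · rfl
  · simp [hx]

/-! ### The witness -/

/-- **Eliashberg's fold map at the round sphere** (Gromov 1986, §2.1.3 (D), Example): the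
conclusion of the named fact `Literature.Topology.FourManifolds.eliashberg_foldMap_homotopySphere_four`
holds for `M = S⁴` with `e = σ⁻¹` (inverse equatorial stereographic projection) and `f` the
vertical projection `x ↦ x'`, folding along the equator `e(S³)`. Non-vacuity witness of the
fact's Lean reading. [cite: Gromov1986, §2.1.3 (D) Example] -/
theorem eliashberg_foldMap_sphere :
    ∃ (e : EuclideanSpace ℝ (Fin 4) → sphere (0 : EuclideanSpace ℝ (Fin 5)) 1)
      (f : sphere (0 : EuclideanSpace ℝ (Fin 5)) 1 → EuclideanSpace ℝ (Fin 4)),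
      ContMDiff (𝓡 4) (𝓡 4) ∞ e ∧ Topology.IsEmbedding e ∧
      (∀ y, Function.Injective (mfderiv (𝓡 4) (𝓡 4) e y)) ∧
      ContMDiff (𝓡 4) (𝓡 4) ∞ f ∧
      (∀ x, x ∉ Set.range (fun n : Metric.sphere (0 : EuclideanSpace ℝ (Fin 4)) 1 => e n) →
        Function.Injective (mfderiv (𝓡 4) (𝓡 4) f x)) ∧
      (∀ n : Metric.sphere (0 : EuclideanSpace ℝ (Fin 4)) 1,
        ∃ (φ : OpenPartialHomeomorph (sphere (0 : EuclideanSpace ℝ (Fin 5)) 1) (EuclideanSpace ℝ (Fin 4)))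
          (ψ : OpenPartialHomeomorph (EuclideanSpace ℝ (Fin 4)) (EuclideanSpace ℝ (Fin 4))),
          e n ∈ φ.source ∧ φ ∈ IsManifold.maximalAtlas (𝓡 4) ∞ (sphere (0 : EuclideanSpace ℝ (Fin 5)) 1) ∧
          ψ ∈ IsManifold.maximalAtlas (𝓡 4) ∞ (EuclideanSpace ℝ (Fin 4)) ∧
          φ.source ⊆ f ⁻¹' ψ.source ∧
          (∀ x ∈ φ.source, ψ (f x) = φ x + ((φ x 0) ^ 2 - φ x 0) •
            EuclideanSpace.single (0 : Fin 4) (1 : ℝ)) ∧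
          (∀ x ∈ φ.source,
            x ∈ Set.range (fun n : Metric.sphere (0 : EuclideanSpace ℝ (Fin 4)) 1 => e n) ↔
              φ x 0 = 0)) := by
  haveI : Fact (Module.finrank ℝ (EuclideanSpace ℝ (Fin 5)) = 4 + 1) := ⟨finrank_euclideanSpace_fin⟩
  refine ⟨stereoSouth.symm, fun x => projFour (x : EuclideanSpace ℝ (Fin 5)),
    contMDiff_stereoSouth_symm, isEmbedding_stereoSouth_symm, injective_mfderiv_stereoSouth_symm,
    projFour.contDiff.contMDiff.comp contMDiff_coe_sphere, ?_, ?_⟩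
  · -- regular off the equator
    intro x hx
    apply injective_mfderiv_projFour_sphere
    intro h0
    exact hx (mem_range_of_apply_four_eq_zero x h0)
  · -- fold charts at each equator point
    intro n
    -- a coordinate with `nᵢ ≠ 0`, and its sign
    obtain ⟨i, hi⟩ : ∃ i, (n : EuclideanSpace ℝ (Fin 4)) i ≠ 0 := by
      by_contra h
      push Not at h
      have h0 : (n : EuclideanSpace ℝ (Fin 4)) = 0 := by ext i; simpa using h i
      have h1 := norm_eq_of_mem_sphere n
      rw [h0, norm_zero] at h1
      exact zero_ne_one h1
    set ε : ℝ := if 0 < (n : EuclideanSpace ℝ (Fin 4)) i then 1 else -1 with hεdef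
    have hε : ε = 1 ∨ ε = -1 := by
      by_cases h : 0 < (n : EuclideanSpace ℝ (Fin 4)) i
      · exact Or.inl (by simp [hεdef, h])
      · exact Or.inr (by simp [hεdef, h])
    have hεn : 0 < ε * (n : EuclideanSpace ℝ (Fin 4)) i := by
      by_cases h : 0 < (n : EuclideanSpace ℝ (Fin 4)) i
      · simp [hεdef, h]
      · have h' : (n : EuclideanSpace ℝ (Fin 4)) i < 0 := lt_of_le_of_ne (not_lt.1 h) hi
        simp [hεdef, h]
        linarith
    have hn_src : stereoSouth.symm n ∈ stereoSouth.source :=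
      stereoSouth.map_target (by simp [stereoSouth_target])
    have hn_val : stereoSouth (stereoSouth.symm n) = n :=
      stereoSouth.right_inv (by simp [stereoSouth_target])
    refine ⟨foldChartSource i ε hε, foldChartTarget i ε hε, ?_, foldChartSource_mem_maximalAtlas i ε hε,
      foldChartTarget_mem_maximalAtlas i ε hε, ?_, ?_, ?_⟩
    · exact ⟨hn_src, by show 0 < ε * stereoSouth (stereoSouth.symm n) i; rwa [hn_val]⟩
    · intro x hx
      obtain ⟨hx1, hx2⟩ := hx
      show 0 < ε * projFour (x : EuclideanSpace ℝ (Fin 5)) i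
      rw [projFour_eq_smul_stereoSouth x hx1, PiLp.smul_apply, smul_eq_mul]
      have hc : 0 < 2 / (1 + ‖stereoSouth x‖ ^ 2) := by positivity
      have h2 : 0 < ε * stereoSouth x i := hx2
      nlinarith
    · exact fun x hx => foldChart_identity i ε hε x hx
    · exact fun x hx => mem_range_iff_foldChart_zero i ε hε x hx

/-- **Rung 0 at the round sphere through the fold-map lemma**: the pull-back of `ω₀` by the
vertical projection of `S⁴` is a folded symplectic form whose folding hypersurface is the chart
3-sphere `n ↦ σ⁻¹ n` (the equator) — the fold-map pull-back lemma
`isFoldedForm_pullback_of_foldMap` applied to the witness `eliashberg_foldMap_sphere`.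
[cite: Cannasdasilva2010, §1] -/
theorem isFoldedForm_projection_sphere :
    ∃ (e : EuclideanSpace ℝ (Fin 4) → sphere (0 : EuclideanSpace ℝ (Fin 5)) 1)
      (f : sphere (0 : EuclideanSpace ℝ (Fin 5)) 1 → EuclideanSpace ℝ (Fin 4)),
      Manifold.IsSmoothEmbedding (𝓡 4) (𝓡 4) ∞ e ∧
        IsFoldedForm (stdSymplecticMForm.pullback (𝓡 4) f) (sphere (0 : EuclideanSpace ℝ (Fin 4)) 1)
          (fun n => e n) := by
  obtain ⟨e, f, he, hemb, hde, hf, hreg, hfold⟩ := eliashberg_foldMap_sphere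
  exact ⟨e, f, ⟨Literature.Topology.FourManifolds.isImmersion_of_injective_mfderiv he (by simp) hde, hemb⟩,
    isFoldedForm_pullback_of_foldMap he hemb hde hf hreg hfold⟩

end Summit.SmoothPoincare4.SmoothPoincare4.Theorems.FoldedSphereFoldExistence

end
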